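import Summits.PneNP.PneNP.Theorems.ConvexRankGatesLinAlgGateBlindMatroidIntersection

/-!
# Route ConvexRankGates, crux `LinAlgGateBlind` (stmt-PneNP-10681): SG for matroid-intersection term gates (the MI cover)

Support theorem for the crux (vocabulary of `Theorems/ConvexRankGatesLinAlgGateBlindDefs.lean`). The inline class `MI_t`:
gates with data `u, w : [n] → F^D` over a division ring (any `D`, unbounded fan-in) and threshold `θ ≤ t`, accepting `v` iff
some `I ⊆ {i : v_i = 1}` with `#I = θ` has both `(u_i)_{i∈I}` and `(w_i)_{i∈I}` independent — the generic-rank threshold of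
the rank-one pencil `∑_{v_i = 1} X_i u_i w_iᵀ` (Edmonds 1967), containing the Kőnig, Hall-cover and rank-threshold
(`LINRANK_t`) gates of the tree. `sgAt_matroidInter_of_chain_budget` proves the finite single-gate statement with cover
exponent `t` in `2·#𝒱(l)` (bits `t (1 + log₂ #𝒱(l))`, vs. `s²` for general GRANK):

a rejected graph has, by linear matroid intersection (`exists_rankCover_of_no_common_independent`), a covering pair
`(P, Q)` of the live inputs (`u_a ∈ P ∨ w_a ∈ Q`) with `dim P + dim Q < θ`, tightened by `exists_tight_pair`; the cover
event "every atom carrying an uncovered input is absent" is rejecting (`card_le_finrank_add_finrank_of_cover`). Inputs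
SHARING an atom forbid describing `(P, Q)` by the atoms of bases alone; instead the event is indexed by `≤ t` atoms AND
`t` bits, and DECODED by a capped greedy branching over the inputs on the listed atoms (first uncovered input: put `u_a`
into `P` or `w_a` into `Q` according to the next bit) — along the bits consistent with the tight pair the branching
returns exactly `(P, Q)` (minimality of a tight pair among covering pairs of the listed inputs), and every decoded pair has
`dim P + dim Q < θ` by the cap. Sources: Edmonds 1967/1970; Razborov 1985, Alon–Boppana 1987 §3; the planting theorem
`sg_of_maxtermCover` is the tree's. No new definitions. [folklore]
-/

-- `Summit.PneNP.PneNP.…` duplicates `PneNP` BY DESIGN (single-problem summit).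
set_option linter.dupNamespace false

noncomputable section

namespace Summit.PneNP.PneNP.Theorems

open Finset Filter Literature.Computability.Complexity Razborov
open Summit.PneNP.PneNP.Cruxes.LinAlgGateBlind.DnfInvariantWideGatesSeeSmallCliques

/-- **SG for matroid-intersection term gates under the two planting budgets (the MI cover).** Let `0 ≤ q ≤ 1`,
`1 - q^{C(l,2)} ≤ 1/2`, `0 < ε`, `2tt ≤ l`, the POSITIVE budget `(ν·C(l,2))^{tt} · C(m-tt, k-tt) ≤ ε·C(m,k)` and the
FRAGILITY budget `(2·#𝒱(l))^t · (1/2)^{ν+1} · #𝒱(l) < ε`. Then `SGAt m (MI_t) l k q ε`. Cover: index `(f, β)` with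
`f : Fin t → 𝒱(l)` (atoms) and `β : Fin t → Bool` (branching bits); decode `(P, Q)` by `t` capped greedy steps over the inputs
whose atom is listed (first input with `u_a ∉ P ∧ w_a ∉ Q`: adjoin `w_a` to `Q` if the bit is set, else `u_a` to `P`,
only while `dim P + dim Q + 1 < θ`); the event is "every atom carrying an input with `u_a ∉ P ∧ w_a ∉ Q` is absent".
(⇐) such a graph's live inputs are covered by `(P, Q)`, `dim P + dim Q < θ`, so no common independent `θ`-set is live;
(⇒) for a rejected graph list the atoms of bases of a TIGHT covering pair of the live inputs (linear matroid intersection +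
`exists_tight_pair`) and the bits it dictates: the decoder returns that pair. [folklore] -/
theorem sgAt_matroidInter_of_chain_budget : ∀ (m l k t ν tt : ℕ) (q ε : ℝ), 0 ≤ q → q ≤ 1 →
    1 - q ^ (l.choose 2) ≤ 1 / 2 → 0 < ε → 2 * tt ≤ l →
    (((ν * l.choose 2) ^ tt * (m - tt).choose (k - tt) : ℕ) : ℝ) ≤ ε * (m.choose k : ℝ) →
    ((2 : ℝ) * #(smallSets (Fin m) l)) ^ t * (1 / 2) ^ (ν + 1) * #(smallSets (Fin m) l) < ε →
    SGAt m (fun g => ∃ (F : Type) (_ : DivisionRing F) (D θ : ℕ), θ ≤ t ∧ ∃ u w : Fin g.1 → (Fin D → F),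
      ∀ v : Fin g.1 → Bool, g.2 v = true ↔ ∃ I : Finset (Fin g.1), (∀ i ∈ I, v i = true) ∧ #I = θ ∧
        Module.finrank F (Submodule.span F (u '' (I : Set (Fin g.1)))) = θ ∧
        Module.finrank F (Submodule.span F (w '' (I : Set (Fin g.1)))) = θ) l k q ε := by
  intro m l k t ν tt q ε hq0 hq1 hql hε htl hpos hfrag O hO
  classical
  obtain ⟨g, ⟨F, _, D, θ, hθt, u, w, hg⟩, X, hX, hOX⟩ := hO
  set V := smallSets (Fin m) l with hVdef
  have hV : (0 : ℝ) < #V := Nat.cast_pos.2 (card_pos.2 ⟨∅, empty_mem_smallSets l⟩)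
  have hV1 : (1 : ℝ) ≤ #V := by exact_mod_cast card_pos.2 ⟨∅, empty_mem_smallSets l⟩
  -- the live inputs of a graph
  have hO_iff : ∀ x, O x = true ↔ ∃ I : Finset (Fin g.1), (∀ i ∈ I, CliquePresent (X i) x) ∧ #I = θ ∧
      Module.finrank F (Submodule.span F (u '' (I : Set (Fin g.1)))) = θ ∧
      Module.finrank F (Submodule.span F (w '' (I : Set (Fin g.1)))) = θ := by
    intro x
    rw [hOX x, hg]
    simp [atomB]
  -- degenerate threshold: the gate is constantly true, one never-realised event suffices
  rcases Nat.eq_zero_or_pos θ with hθ0 | hθpos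
  · have htrue : ∀ x, O x = true := fun x => (hO_iff x).2 ⟨∅, by simp, by simp [hθ0], by simp [hθ0], by simp [hθ0]⟩
    have hN : ((1 : ℕ) : ℝ) * (1 / 2) ^ (ν + 1) < ε / #V := by
      rw [lt_div_iff₀ hV, Nat.cast_one, one_mul]
      have h1 : (1 : ℝ) ≤ ((2 : ℝ) * #V) ^ t := one_le_pow₀ (by linarith)
      calc (1 / 2 : ℝ) ^ (ν + 1) * #V ≤ ((2 : ℝ) * #V) ^ t * (1 / 2) ^ (ν + 1) * #V := by
            rw [mul_assoc]
            exact le_mul_of_one_le_left (by positivity) h1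
        _ < ε := hfrag
    obtain ⟨𝒜, h𝒜, hP, hNg⟩ := sg_of_maxtermCover m l k 1 ν tt q (ε / #V) O (fun _ => {∅})
      (fun _ => singleton_subset_iff.2 (empty_mem_smallSets l))
      (fun x hx => by simp [htrue x] at hx)
      (fun _ x hall => absurd (cliquePresent_empty x) (hall ∅ (mem_singleton_self _)))
      hq0 hq1 hql (div_pos hε hV) hN htl
    refine ⟨𝒜, h𝒜, ?_, hNg.trans_eq (mul_div_cancel₀ ε hV.ne')⟩
    calc (#(lostPos m k O 𝒜) : ℝ) ≤ (((ν * l.choose 2) ^ tt * (m - tt).choose (k - tt) : ℕ) : ℝ) := by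
          exact_mod_cast hP
      _ ≤ ε * (m.choose k : ℝ) := hpos
  -- the decoder: capped greedy branching over the inputs whose atom is listed (opaque local functions)
  obtain ⟨dom, hdom⟩ : ∃ dom : (Fin t → V) → Finset (Fin g.1),
      ∀ f, dom f = univ.filter fun a => ∃ i, ((f i : V) : Finset (Fin m)) = X a := ⟨_, fun _ => rfl⟩
  obtain ⟨step, hstep⟩ : ∃ step : Finset (Fin g.1) → Submodule F (Fin D → F) × Submodule F (Fin D → F) → Bool →
      Submodule F (Fin D → F) × Submodule F (Fin D → F), ∀ E s b, step E s b =
        if Module.finrank F s.1 + Module.finrank F s.2 + 1 < θ then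
          (if hex : ∃ a, a ∈ E ∧ ¬ (u a ∈ s.1 ∨ w a ∈ s.2) then
            (if b then (s.1, s.2 ⊔ (F ∙ w (Fin.find _ hex))) else (s.1 ⊔ (F ∙ u (Fin.find _ hex)), s.2))
          else s)
        else s := ⟨_, fun _ _ _ => rfl⟩
  obtain ⟨dec, hdec⟩ : ∃ dec : (Fin t → V) × (Fin t → Bool) → Submodule F (Fin D → F) × Submodule F (Fin D → F),
      ∀ f β, dec (f, β) = (List.ofFn β).foldl (step (dom f)) (⊥, ⊥) := ⟨fun j => (List.ofFn j.2).foldl (step (dom j.1)) (⊥, ⊥), fun _ _ => rfl⟩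
  -- one step raises the total dimension by at most one, and only below the cap
  have hline : ∀ (S : Submodule F (Fin D → F)) (y : Fin D → F),
      Module.finrank F ↥(S ⊔ (F ∙ y)) ≤ Module.finrank F S + 1 := fun S y =>
    (Submodule.finrank_add_le_finrank_add_finrank _ _).trans (by
      gcongr; exact (finrank_span_le_card ({y} : Set (Fin D → F))).trans (by simp))
  have hstep_small : ∀ E s b, Module.finrank F s.1 + Module.finrank F s.2 < θ →
      Module.finrank F (step E s b).1 + Module.finrank F (step E s b).2 < θ := by
    intro E s b hs
    rw [hstep]
    by_cases hcap : Module.finrank F s.1 + Module.finrank F s.2 + 1 < θ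
    · rw [if_pos hcap]
      by_cases hex : ∃ a, a ∈ E ∧ ¬ (u a ∈ s.1 ∨ w a ∈ s.2)
      · rw [dif_pos hex]
        have h1 := hline s.1 (u (Fin.find _ hex))
        have h2 := hline s.2 (w (Fin.find _ hex))
        cases b
        · rw [if_neg Bool.false_ne_true]
          show Module.finrank F ↥(s.1 ⊔ (F ∙ u (Fin.find _ hex))) + Module.finrank F s.2 < θ
          omega
        · rw [if_pos rfl]
          show Module.finrank F s.1 + Module.finrank F ↥(s.2 ⊔ (F ∙ w (Fin.find _ hex))) < θ
          omega
      · rw [dif_neg hex]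
        exact hs
    · rw [if_neg hcap]
      exact hs
  have hfold_small : ∀ E (lst : List Bool) (s : Submodule F (Fin D → F) × Submodule F (Fin D → F)),
      Module.finrank F s.1 + Module.finrank F s.2 < θ →
      Module.finrank F (lst.foldl (step E) s).1 + Module.finrank F (lst.foldl (step E) s).2 < θ := by
    intro E lst
    induction lst with
    | nil => intro s hs; exact hs
    | cons b lst ih => intro s hs; exact ih _ (hstep_small E s b hs)
  have hdec_small : ∀ j, Module.finrank F (dec j).1 + Module.finrank F (dec j).2 < θ := fun j => by
    obtain ⟨f, β⟩ := j
    rw [hdec]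
    exact hfold_small _ _ _ (by simpa using hθpos)
  -- index the cover
  set N := Nat.card ((Fin t → V) × (Fin t → Bool)) with hNdef
  set e : (Fin t → V) × (Fin t → Bool) ≃ Fin N := Finite.equivFin _ with he
  set 𝓛 : Fin N → Finset (Finset (Fin m)) :=
    fun j => (univ.filter fun a => ¬ (u a ∈ (dec (e.symm j)).1 ∨ w a ∈ (dec (e.symm j)).2)).image X with h𝓛
  have hNle : (N : ℝ) ≤ ((2 : ℝ) * #V) ^ t := by
    have h2 : N = (2 * #V) ^ t := by
      rw [hNdef, Nat.card_prod, Nat.card_eq_fintype_card, Nat.card_eq_fintype_card, Fintype.card_fun, Fintype.card_fun,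
        Fintype.card_fin, Fintype.card_coe, Fintype.card_bool, mul_pow, mul_comm]
    rw [h2]
    push_cast
    exact le_rfl
  have hN : (N : ℝ) * (1 / 2) ^ (ν + 1) < ε / #V := by
    rw [lt_div_iff₀ hV]
    calc (N : ℝ) * (1 / 2) ^ (ν + 1) * #V ≤ ((2 : ℝ) * #V) ^ t * (1 / 2) ^ (ν + 1) * #V := by gcongr
      _ < ε := hfrag
  have h1 : ∀ j, 𝓛 j ⊆ V := by
    intro j Y hY
    obtain ⟨a, -, rfl⟩ := mem_image.1 hY
    exact hX a
  -- (⇐) a graph realising an event is rejected: its live inputs are covered by a pair of total dimension `< θ`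
  have h3 : ∀ j x, (∀ Y ∈ 𝓛 j, ¬ CliquePresent Y x) → O x = false := by
    intro j x hall
    cases hx : O x
    · rfl
    · exfalso
      obtain ⟨I, hIlive, hIcard, hIu, hIw⟩ := (hO_iff x).1 hx
      have hcov : ∀ i ∈ I, u i ∈ (dec (e.symm j)).1 ∨ w i ∈ (dec (e.symm j)).2 := by
        intro i hi
        by_contra hbad
        exact hall (X i) (mem_image_of_mem X (mem_filter.2 ⟨mem_univ i, hbad⟩)) (hIlive i hi)
      have hle := card_le_finrank_add_finrank_of_cover (F := F) u w I _ _ (hIcard ▸ hIu) (hIcard ▸ hIw) hcov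
      have := hdec_small (e.symm j)
      omega
  -- (⇒) a rejected graph realises the event of its tight covering pair
  have h2 : ∀ x, O x = false → ∃ j, ∀ Y ∈ 𝓛 j, ¬ CliquePresent Y x := by
    intro x hx
    set L : Finset (Fin g.1) := univ.filter fun a => CliquePresent (X a) x with hL
    -- no common independent `θ`-set is live
    have hno : ¬ ∃ I ⊆ L, #I = θ ∧ Module.finrank F (Submodule.span F (u '' (I : Set (Fin g.1)))) = θ ∧
        Module.finrank F (Submodule.span F (w '' (I : Set (Fin g.1)))) = θ := by
      rintro ⟨I, hIL, hIcard, hIu, hIw⟩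
      have htrue := (hO_iff x).2 ⟨I, fun i hi => (mem_filter.1 (hIL hi)).2, hIcard, hIu, hIw⟩
      rw [hx] at htrue
      exact Bool.false_ne_true htrue
    -- linear matroid intersection: a covering pair of small total dimension, then a tight one below it
    obtain ⟨T, hTL, hT⟩ := exists_rankCover_of_no_common_independent (F := F) u w L θ hno
    obtain ⟨P, Q, hPP₀, hQQ₀, hvalid, hPt, hQt⟩ := exists_tight_pair (F := F) u w (L : Set (Fin g.1))
      (Submodule.span F (u '' (T : Set (Fin g.1)))) (Submodule.span F (w '' ((L \ T : Finset (Fin g.1)) : Set (Fin g.1))))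
      (fun a ha => by
        by_cases haT : a ∈ T
        · exact Or.inl (Submodule.subset_span ⟨a, haT, rfl⟩)
        · exact Or.inr (Submodule.subset_span ⟨a, by simpa using And.intro ha haT, rfl⟩))
    have hsmall : Module.finrank F P + Module.finrank F Q < θ :=
      lt_of_le_of_lt (add_le_add (Submodule.finrank_mono hPP₀) (Submodule.finrank_mono hQQ₀)) hT
    -- bases of `P` and `Q` among the tightly covered live inputs
    set L₁ : Finset (Fin g.1) := L.filter fun a => w a ∉ Q with hL₁
    set L₂ : Finset (Fin g.1) := L.filter fun a => u a ∉ P with hL₂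
    have hL₁set : (L₁ : Set (Fin g.1)) = {a | a ∈ (L : Set (Fin g.1)) ∧ w a ∉ Q} := by
      ext a; simp [hL₁]
    have hL₂set : (L₂ : Set (Fin g.1)) = {a | a ∈ (L : Set (Fin g.1)) ∧ u a ∉ P} := by
      ext a; simp [hL₂]
    have hPspan : Submodule.span F (u '' (L₁ : Set (Fin g.1))) = P := by rw [hL₁set, ← hPt]
    have hQspan : Submodule.span F (w '' (L₂ : Set (Fin g.1))) = Q := by rw [hL₂set, ← hQt]
    obtain ⟨B₁, hB₁L₁, hB₁card, hB₁span⟩ := exists_subset_card_le_finrank_span_image (F := F) u L₁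
    obtain ⟨B₂, hB₂L₂, hB₂card, hB₂span⟩ := exists_subset_card_le_finrank_span_image (F := F) w L₂
    rw [hPspan] at hB₁card hB₁span
    rw [hQspan] at hB₂card hB₂span
    -- list the atoms of `B₁ ∪ B₂` as a `t`-tuple padded with `∅`
    set 𝒥 : Finset (Finset (Fin m)) := (B₁ ∪ B₂).image X with h𝒥def
    have h𝒥V : 𝒥 ⊆ V := by
      intro Y hY
      obtain ⟨a, -, rfl⟩ := mem_image.1 hY
      exact hX a
    have h𝒥card : #𝒥 ≤ t :=
      card_image_le.trans ((card_union_le _ _).trans (by omega))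
    set e𝒥 := 𝒥.equivFin with he𝒥
    set f : Fin t → V := fun i =>
      if h : (i : ℕ) < #𝒥 then ⟨(e𝒥.symm ⟨i, h⟩ : Finset (Fin m)), h𝒥V (e𝒥.symm ⟨i, h⟩).2⟩
      else ⟨∅, empty_mem_smallSets l⟩ with hfdef
    -- the inputs on listed atoms are live, and contain `B₁ ∪ B₂`
    have hdomL : dom f ⊆ L := by
      intro a ha
      rw [hdom] at ha
      obtain ⟨i, hi⟩ := (mem_filter.1 ha).2
      rw [hL, mem_filter]
      refine ⟨mem_univ a, ?_⟩
      by_cases h : (i : ℕ) < #𝒥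
      · have hmem : X a ∈ 𝒥 := by
          rw [← hi, hfdef]
          simp only [h, dif_pos]
          exact (e𝒥.symm ⟨i, h⟩).2
        obtain ⟨b, hb, hba⟩ := mem_image.1 hmem
        have hbL : b ∈ L := by
          rcases mem_union.1 hb with hb | hb
          · exact (mem_filter.1 (hB₁L₁ hb)).1
          · exact (mem_filter.1 (hB₂L₂ hb)).1
        rw [← hba]
        exact (mem_filter.1 hbL).2
      · have hempty : X a = ∅ := by
          rw [← hi, hfdef]
          simp only [h, dif_neg, not_false_eq_true]
        rw [hempty]
        exact cliquePresent_empty x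
    have hBdom : B₁ ∪ B₂ ⊆ dom f := by
      intro b hb
      have hXb : X b ∈ 𝒥 := mem_image_of_mem X hb
      rw [hdom, mem_filter]
      refine ⟨mem_univ b, ⟨e𝒥 ⟨X b, hXb⟩, lt_of_lt_of_le (e𝒥 ⟨X b, hXb⟩).2 h𝒥card⟩, ?_⟩
      rw [hfdef]
      simp only [(e𝒥 ⟨X b, hXb⟩).2, dif_pos, Fin.eta, Equiv.symm_apply_apply]
    -- `(P, Q)` is minimal among the covering pairs of the listed inputs
    have hmin : ∀ (P' Q' : Submodule F (Fin D → F)), P' ≤ P → Q' ≤ Q → (∀ a ∈ dom f, u a ∈ P' ∨ w a ∈ Q') →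
        P ≤ P' ∧ Q ≤ Q' := by
      intro P' Q' hP' hQ' hcov
      constructor
      · rw [← hB₁span]
        refine Submodule.span_le.2 ?_
        rintro _ ⟨b, hb, rfl⟩
        have hbQ : w b ∉ Q := (mem_filter.1 (hB₁L₁ hb)).2
        exact (hcov b (hBdom (mem_union_left _ hb))).resolve_right fun h => hbQ (hQ' h)
      · rw [← hB₂span]
        refine Submodule.span_le.2 ?_
        rintro _ ⟨b, hb, rfl⟩
        have hbP : u b ∉ P := (mem_filter.1 (hB₂L₂ hb)).2
        exact (hcov b (hBdom (mem_union_right _ hb))).resolve_left fun h => hbP (hP' h)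
    have hvalid_dom : ∀ a ∈ dom f, u a ∈ P ∨ w a ∈ Q := fun a ha => hvalid a (by exact_mod_cast hdomL ha)
    -- completeness of the decoder along the bits dictated by `(P, Q)`
    have hrun : ∀ n : ℕ, ∃ lst : List Bool, lst.length = n ∧
        (lst.foldl (step (dom f)) (⊥, ⊥)).1 ≤ P ∧ (lst.foldl (step (dom f)) (⊥, ⊥)).2 ≤ Q ∧
        ((∀ a ∈ dom f, u a ∈ (lst.foldl (step (dom f)) (⊥, ⊥)).1 ∨ w a ∈ (lst.foldl (step (dom f)) (⊥, ⊥)).2) ∨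
          Module.finrank F (lst.foldl (step (dom f)) (⊥, ⊥)).1 +
            Module.finrank F (lst.foldl (step (dom f)) (⊥, ⊥)).2 = n) := by
      intro n
      induction n with
      | zero =>
        refine ⟨[], rfl, bot_le, bot_le, Or.inr ?_⟩
        show Module.finrank F (⊥ : Submodule F (Fin D → F)) + Module.finrank F (⊥ : Submodule F (Fin D → F)) = 0
        rw [finrank_bot]
      | succ n ih =>
        obtain ⟨lst, hlen, hP', hQ', hor⟩ := ih
        set s := lst.foldl (step (dom f)) (⊥, ⊥) with hs
        by_cases hval : ∀ a ∈ dom f, u a ∈ s.1 ∨ w a ∈ s.2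
        · -- everything covered: any further bit is idle
          refine ⟨lst ++ [false], by simp [hlen], ?_⟩
          have hidle : step (dom f) s false = s := by
            have hnex : ¬ ∃ a, a ∈ dom f ∧ ¬ (u a ∈ s.1 ∨ w a ∈ s.2) := by
              rintro ⟨a, ha, hna⟩
              exact hna (hval a ha)
            rw [hstep, dif_neg hnex, ite_self]
          rw [List.foldl_append, List.foldl_cons, List.foldl_nil, ← hs, hidle]
          exact ⟨hP', hQ', Or.inl hval⟩
        · -- an uncovered listed input: branch on it
          push Not at hval
          have htot : Module.finrank F s.1 + Module.finrank F s.2 = n := by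
            rcases hor with hor | hor
            · obtain ⟨a, ha, hua, hwa⟩ := hval
              exact absurd (hor a ha) (by tauto)
            · exact hor
          -- below the cap, since `s ≠ (P, Q)` componentwise-below `(P, Q)`
          have hcap : Module.finrank F s.1 + Module.finrank F s.2 + 1 < θ := by
            by_contra hge
            have h1 := Submodule.finrank_mono hP'
            have h2 := Submodule.finrank_mono hQ'
            have heq1 : Module.finrank F s.1 = Module.finrank F P := by omega
            have heq2 : Module.finrank F s.2 = Module.finrank F Q := by omega
            have hs1 : s.1 = P := Submodule.eq_of_le_of_finrank_eq hP' heq1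
            have hs2 : s.2 = Q := Submodule.eq_of_le_of_finrank_eq hQ' heq2
            obtain ⟨a, ha, hua, hwa⟩ := hval
            rw [hs1] at hua
            rw [hs2] at hwa
            rcases hvalid_dom a ha with h | h
            · exact hua h
            · exact hwa h
          have hex : ∃ a, a ∈ dom f ∧ ¬ (u a ∈ s.1 ∨ w a ∈ s.2) := by
            obtain ⟨a, ha, hua, hwa⟩ := hval
            exact ⟨a, ha, by tauto⟩
          set a₀ := Fin.find _ hex with ha₀def
          obtain ⟨ha₀dom, ha₀bad⟩ : a₀ ∈ dom f ∧ ¬ (u a₀ ∈ s.1 ∨ w a₀ ∈ s.2) := Fin.find_spec hex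
          by_cases hu : u a₀ ∈ P
          · refine ⟨lst ++ [false], by simp [hlen], ?_⟩
            have hnext : step (dom f) s false = (s.1 ⊔ (F ∙ u a₀), s.2) := by
              rw [hstep, if_pos hcap, dif_pos hex]
              simp only [Bool.false_eq_true, ↓reduceIte, ha₀def]
            rw [List.foldl_append, List.foldl_cons, List.foldl_nil, ← hs, hnext]
            refine ⟨sup_le hP' ((Submodule.span_singleton_le_iff_mem _ _).2 hu), hQ', Or.inr ?_⟩
            dsimp only
            rw [finrank_sup_span_singleton_eq s.1 (fun h => ha₀bad (Or.inl h))]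
            omega
          · have hwQ : w a₀ ∈ Q := (hvalid_dom a₀ ha₀dom).resolve_left hu
            refine ⟨lst ++ [true], by simp [hlen], ?_⟩
            have hnext : step (dom f) s true = (s.1, s.2 ⊔ (F ∙ w a₀)) := by
              rw [hstep, if_pos hcap, dif_pos hex]
              simp only [↓reduceIte, ha₀def]
            rw [List.foldl_append, List.foldl_cons, List.foldl_nil, ← hs, hnext]
            refine ⟨hP', sup_le hQ' ((Submodule.span_singleton_le_iff_mem _ _).2 hwQ), Or.inr ?_⟩
            dsimp only
            rw [finrank_sup_span_singleton_eq s.2 (fun h => ha₀bad (Or.inr h))]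
            omega
    obtain ⟨lst, hlen, hP', hQ', hor⟩ := hrun t
    obtain ⟨β, hofFn⟩ : ∃ β : Fin t → Bool, List.ofFn β = lst :=
      ⟨fun i => lst.get (i.cast hlen.symm), by
        apply List.ext_get
        · simp [hlen]
        · intro i h1 h2
          simp only [List.get_eq_getElem, List.getElem_ofFn]
          rfl⟩
    have hdecj : dec (f, β) = (P, Q) := by
      have hfold : dec (f, β) = lst.foldl (step (dom f)) (⊥, ⊥) := by
        rw [hdec, hofFn]
      have hval : ∀ a ∈ dom f, u a ∈ (lst.foldl (step (dom f)) (⊥, ⊥)).1 ∨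
          w a ∈ (lst.foldl (step (dom f)) (⊥, ⊥)).2 := by
        rcases hor with hor | hor
        · exact hor
        · exfalso
          have h1 := Submodule.finrank_mono hP'
          have h2 := Submodule.finrank_mono hQ'
          omega
      obtain ⟨hPle, hQle⟩ := hmin _ _ hP' hQ' hval
      rw [hfold]
      exact Prod.ext (le_antisymm hP' hPle) (le_antisymm hQ' hQle)
    refine ⟨e (f, β), fun Y hY => ?_⟩
    obtain ⟨a, ha, rfl⟩ := mem_image.1 hY
    rw [mem_filter, Equiv.symm_apply_apply, hdecj] at ha
    intro hpres
    have haL : a ∈ L := by rw [hL, mem_filter]; exact ⟨mem_univ a, hpres⟩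
    exact ha.2 (hvalid a (by exact_mod_cast haL))
  obtain ⟨𝒜, h𝒜, hP, hNg⟩ := sg_of_maxtermCover m l k N ν tt q (ε / #V) O 𝓛 h1 h2 h3
    hq0 hq1 hql (div_pos hε hV) hN htl
  refine ⟨𝒜, h𝒜, ?_, hNg.trans_eq (mul_div_cancel₀ ε hV.ne')⟩
  calc (#(lostPos m k O 𝒜) : ℝ) ≤ (((ν * l.choose 2) ^ tt * (m - tt).choose (k - tt) : ℕ) : ℝ) := by
        exact_mod_cast hP
    _ ≤ ε * (m.choose k : ℝ) := hpos

end Summit.PneNP.PneNP.Theorems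

end
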